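import Mathlib
import Literature.Probability.LatticeModels.GKSInequalities
import Summits.CriticalPhenomena.Ising3DConformalLimit.Theses.PrecisionLaplacian

/-!
# Sketch — crux-ideate stmt-CriticalPhenomena-4798 (InverseMFerromagnet), ideator 2, round 1

First-lemma signatures of the idea cards (they need not be proved here; they must elaborate).
All statements are over the crux's own constants `gksExpect`, `spinAt`, `spinProduct`
(Literature.Probability.LatticeModels.GKSInequalities / Correlations) and Mathlib's `Matrix.inv`.
-/

open Literature.Probability.LatticeModels
open scoped BigOperators

namespace Summit.CriticalPhenomena.Ising3DConformalLimit.Cruxes.InverseMFerromagnet.Sketch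

/-- The spin second-moment matrix `Σ_pq = ⟨σ_p σ_q⟩` of the zero-field pair system of the crux. -/
noncomputable def corrMatrix (n m : ℕ) (K : Fin m → ℝ) (C : Fin m → Finset (Fin n)) :
    Matrix (Fin n) (Fin n) ℝ :=
  Matrix.of fun p q => gksExpect Finset.univ K C (fun ω => spinAt p ω * spinAt q ω)

/-- The local field `h_x(ω) = Σ_{i : x ∈ C_i} K_i ω_{C_i ∖ x}` (for pair sets `C_i`, the coupling times
the neighbouring spin). -/
noncomputable def localField (n m : ℕ) (K : Fin m → ℝ) (C : Fin m → Finset (Fin n)) (x : Fin n)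
    (ω : SpinConfig (Fin n)) : ℝ :=
  ∑ i, if x ∈ C i then K i * spinProduct ((C i).erase x) ω else 0

/-- The total coupling on the pair `{x, y}`: `K_xy = Σ_{i : C_i = {x,y}} K_i`. -/
noncomputable def pairCoupling (n m : ℕ) (K : Fin m → ℝ) (C : Fin m → Finset (Fin n))
    (x y : Fin n) : ℝ :=
  ∑ i, if C i = {x, y} then K i else 0

/-! ## Card A (cubic-gadget-star-triangle): first lemma and the conjectured inequality (R3) -/

/-- FIRST LEMMA (card A): Walsh expansion of `tanh` on three spins — the linear coefficients are
nonnegative and the cubic coefficient is nonpositive when the three couplings are nonnegative.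
(Elementary: `c₃ = ¼[tanh(K₁+K₂+K₃) − tanh(K₁+K₂−K₃) − tanh(K₁−K₂+K₃) + tanh(K₁−K₂−K₃)] ≤ 0`
is the third symmetric difference of the concave-on-`ℝ₊`, odd function `tanh`.) -/
def ThreeSpinTanhSigns : Prop :=
  ∀ K₁ K₂ K₃ : ℝ, 0 ≤ K₁ → 0 ≤ K₂ → 0 ≤ K₃ →
    let f : ℝ → ℝ → ℝ → ℝ := fun s₁ s₂ s₃ => Real.tanh (K₁ * s₁ + K₂ * s₂ + K₃ * s₃)
    let ℓ₁ := (f 1 1 1 + f 1 1 (-1) + f 1 (-1) 1 + f 1 (-1) (-1)) / 4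
    let ℓ₂ := (f 1 1 1 + f 1 1 (-1) - f 1 (-1) 1 - f 1 (-1) (-1)) / 4
    let ℓ₃ := (f 1 1 1 - f 1 1 (-1) + f 1 (-1) 1 - f 1 (-1) (-1)) / 4
    let c₃ := (f 1 1 1 - f 1 1 (-1) - f 1 (-1) 1 + f 1 (-1) (-1)) / 4
    0 ≤ ℓ₁ ∧ 0 ≤ ℓ₂ ∧ 0 ≤ ℓ₃ ∧ c₃ ≤ 0 ∧
      ∀ s₁ s₂ s₃ : ℝ, (s₁ = 1 ∨ s₁ = -1) → (s₂ = 1 ∨ s₂ = -1) → (s₃ = 1 ∨ s₃ = -1) →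
        f s₁ s₂ s₃ = ℓ₁ * s₁ + ℓ₂ * s₂ + ℓ₃ * s₃ + c₃ * (s₁ * s₂ * s₃)

/-- IM restricted to systems in which every site lies in at most three pairs (max degree ≤ 3). -/
def InverseMCubic : Prop :=
  ∀ (n m : ℕ) (K : Fin m → ℝ) (C : Fin m → Finset (Fin n)), (∀ i, 0 ≤ K i) → (∀ i, (C i).card = 2) →
    (∀ x : Fin n, (Finset.univ.filter fun i => x ∈ C i).card ≤ 3) →
    ∀ x y : Fin n, x ≠ y → (corrMatrix n m K C)⁻¹ x y ≤ 0

/-- TRANSFER (card A): the degree-3 gadget reduction — IM for max-degree-3 systems implies the crux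
(split a site of degree `d ≥ 4` into two sites joined by a coupling `M → ∞`; correlations of the
original sites are limits of principal submatrices; inverse-M is closed under principal submatrices
and under entrywise limits with positive-definite limit). -/
def CubicReduction : Prop :=
  InverseMCubic → Summit.CriticalPhenomena.Ising3DConformalLimit.Theses.PrecisionLaplacian.InverseMFerromagnet

/-- CONJECTURE (R3) (card A, the new inequality): the linear-regression coefficient of the triple
product `σ_aσ_bσ_c` on the spin `σ_z`, `z ∉ {a,b,c}`, is nonpositive:
`(Σ⁻¹ w)_z ≤ 0` with `w_q = ⟨σ_aσ_bσ_cσ_q⟩`. Equivalently `U₄(a,b,c,·)` is a nonpositive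
superposition of two-point functions centred outside `{a,b,c}` plus two-point functions centred at
`a,b,c`. 0 violations in 2267 exact instances (kit j005008). -/
def TripleRegressionSign : Prop :=
  ∀ (n m : ℕ) (K : Fin m → ℝ) (C : Fin m → Finset (Fin n)), (∀ i, 0 ≤ K i) → (∀ i, (C i).card = 2) →
    ∀ a b c z : Fin n, a ≠ b → b ≠ c → a ≠ c → z ≠ a → z ≠ b → z ≠ c →
      ((corrMatrix n m K C)⁻¹).mulVec
          (fun q => gksExpect Finset.univ K C
            (fun ω => spinAt a ω * spinAt b ω * spinAt c ω * spinAt q ω)) z ≤ 0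

/-! ## Card B (anharmonic-continuation-score-schur): first lemma and the sharpened target IM♯ -/

/-- FIRST LEMMA (card B, discrete Stein identity): for `y ≠ x`,
`⟨σ_x σ_y⟩ = ⟨tanh(h_x) σ_y⟩` — the innovation `s_x = σ_x − tanh h_x(σ)` is orthogonal to every
function of the other spins, so `Cov(s, σ)` is DIAGONAL. (Finite sum; pair off `ω` and `ω` with
`σ_x` flipped.) -/
def DiscreteSteinIdentity : Prop :=
  ∀ (n m : ℕ) (K : Fin m → ℝ) (C : Fin m → Finset (Fin n)), (∀ i, (C i).card = 2) →
    ∀ x y : Fin n, x ≠ y →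
      gksExpect Finset.univ K C (fun ω => spinAt x ω * spinAt y ω)
        = gksExpect Finset.univ K C (fun ω => Real.tanh (localField n m K C x ω) * spinAt y ω)

/-- SHARPENED TARGET IM♯ (card B): the precision entry is dominated by minus the bare coupling,
`(Σ⁻¹)_xy ≤ −K_xy` (so `≤ 0` off the interaction graph and `≤ −K_xy < 0` on it). It is the
`λ → ∞` endpoint of the same statement for the lattice `φ⁴_λ` field, where it reads
`Cov(R_x, R_y) ≥ 0` for the Wick-type residual `R_x` of the single-site score; 0 violations in
1297 exact Ising instances (kit j005008). IM♯ → the crux trivially. -/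
def InverseMSharp : Prop :=
  ∀ (n m : ℕ) (K : Fin m → ℝ) (C : Fin m → Finset (Fin n)), (∀ i, 0 ≤ K i) → (∀ i, (C i).card = 2) →
    ∀ x y : Fin n, x ≠ y → (corrMatrix n m K C)⁻¹ x y ≤ -pairCoupling n m K C x y

theorem inverseMSharp_implies_crux (h : InverseMSharp) :
    Summit.CriticalPhenomena.Ising3DConformalLimit.Theses.PrecisionLaplacian.InverseMFerromagnet := by
  intro n m K C hK hC x y hxy
  have h1 := h n m K C hK hC x y hxy
  have h2 : 0 ≤ pairCoupling n m K C x y := by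
    unfold pairCoupling
    refine Finset.sum_nonneg fun i _ => ?_
    split_ifs
    · exact hK i
    · exact le_refl 0
  have : (corrMatrix n m K C)⁻¹ x y ≤ 0 := by linarith
  simpa [corrMatrix] using this

/-! ## Card C (ht-cofactor-alternating-flows): the polynomial reformulation -/

/-- The (unnormalised) high-temperature matrix `P_pq(t) = Σ_ω ω_p ω_q Π_i (1 + t_i ω_{C_i})`
(`= 2^n Σ_{F : ∂F = {p} Δ {q}} t^F`, multilinear in the bond variables `t_i`). With `t_i = tanh K_i`
one has `⟨σ_pσ_q⟩_K = P_pq(t) / P_pp(t)` and `P_pp = Σ_ω Π_i (1 + t_i ω_{C_i}) > 0`. -/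
noncomputable def htMatrix (n m : ℕ) (t : Fin m → ℝ) (C : Fin m → Finset (Fin n)) :
    Matrix (Fin n) (Fin n) ℝ :=
  Matrix.of fun p q => ∑ ω : SpinConfig (Fin n), spinAt p ω * spinAt q ω * ∏ i, (1 + t i * spinProduct (C i) ω)

/-- FIRST LEMMA (card C): IM is the sign of an almost-principal minor of the polynomial matrix
`P(t)`: for bond variables in `[0,1)` the adjugate of `P(t)` has nonpositive off-diagonal entries.
(`Σ⁻¹ = P_pp · adj(P) / det P` with `det P > 0`; so this statement implies the crux under
`t = tanh ∘ K`, and conversely.) Conjecture N♭ of the card: `-(adj P)_xy ∈ ℕ[t_i, 1 - t_i²]`. -/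
def HTCofactorSign : Prop :=
  ∀ (n m : ℕ) (t : Fin m → ℝ) (C : Fin m → Finset (Fin n)), (∀ i, 0 ≤ t i ∧ t i < 1) →
    (∀ i, (C i).card = 2) → ∀ x y : Fin n, x ≠ y → (htMatrix n m t C).adjugate x y ≤ 0

/-- The bridge back to the crux (to be proved in crux-plan: `gksExpect` of `σ_pσ_q` equals
`P_pq(tanh ∘ K)/P_pp(tanh ∘ K)`, `det P > 0`, and `A⁻¹ = (det A)⁻¹ • adj A`). -/
def HTCofactorBridge : Prop :=
  HTCofactorSign → Summit.CriticalPhenomena.Ising3DConformalLimit.Theses.PrecisionLaplacian.InverseMFerromagnet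

/-- The structural zero (card C, template for the involution): across a separation of `x` from `y`
by at most two sites the almost-principal minor vanishes identically (refuter fact (ii) on the
crux item, here as a polynomial identity in the bond variables). Stated for a cut pair `{c₁, c₂}`:
every pair set `C i` containing a site of `X` is contained in `X ∪ {c₁, c₂}`, `x ∈ X`, `y ∉ X ∪ {c₁,c₂}`. -/
def HTCofactorCutZero : Prop :=
  ∀ (n m : ℕ) (t : Fin m → ℝ) (C : Fin m → Finset (Fin n)), (∀ i, (C i).card = 2) →
    ∀ (X : Finset (Fin n)) (c₁ c₂ x y : Fin n), x ∈ X → y ∉ X → y ≠ c₁ → y ≠ c₂ → c₁ ∉ X → c₂ ∉ X →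
      (∀ i, (∃ z ∈ C i, z ∈ X) → C i ⊆ X ∪ {c₁, c₂}) →
        (htMatrix n m t C).adjugate x y = 0

/-! ## Card C′ (replica-cross-product): the inverse-free multi-replica form of the crux -/

/-- The replicated pair system: `r` independent copies of the crux's system on `Fin N`, realised as ONE
zero-field pair system on the site set `Fin r × Fin N` (disjoint union of the copies: same couplings,
no interaction between copies), so that its `gksExpect` is the product measure of the replicas. -/
noncomputable def replicaExpect (r N m : ℕ) (K : Fin m → ℝ) (C : Fin m → Finset (Fin N))
    (f : SpinConfig (Fin r × Fin N) → ℝ) : ℝ :=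
  gksExpect (Finset.univ : Finset (Fin m × Fin r)) (fun j => K j.1)
    (fun j => (C j.1).map ⟨fun u => (j.2, u), fun _ _ h => congrArg Prod.snd h⟩) f

/-- The `x`-th component of the integer normal vector ("generalised cross product") of the `n` replica
spin vectors `σ¹, …, σⁿ ∈ {±1}^{n+1}`: `ν_x = (-1)^x det [σ^a_u]_{a, u ≠ x}`. -/
noncomputable def crossComponent (n : ℕ) (x : Fin (n + 1)) (ω : SpinConfig (Fin n × Fin (n + 1))) : ℝ :=
  (-1 : ℝ) ^ (x : ℕ) * (Matrix.of fun (a : Fin n) (u : Fin n) => spinAt (a, x.succAbove u) ω).det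

/-- CONJECTURE / FIRST LEMMA (card C′): the REPLICA CROSS-PRODUCT INEQUALITY. For `n` i.i.d. copies of a
zero-field pair ferromagnet on `n+1` sites, the components of the normal vector to the hyperplane they
span are pairwise NEGATIVELY correlated: `E[ν_x ν_y] ≤ 0` for `x ≠ y`. By Cauchy–Binet
`adj(Σ)_xy = E[ν_x ν_y]/n!`, so this is EQUIVALENT to the crux (given `det Σ > 0`); its cases
`n+1 = 2, 3` are GKS I and GKS II. -/
def ReplicaCrossProductIneq : Prop :=
  ∀ (n m : ℕ) (K : Fin m → ℝ) (C : Fin m → Finset (Fin (n + 1))), (∀ i, 0 ≤ K i) → (∀ i, (C i).card = 2) →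
    ∀ x y : Fin (n + 1), x ≠ y →
      replicaExpect n (n + 1) m K C (fun ω => crossComponent n x ω * crossComponent n y ω) ≤ 0

/-- The bridge (Cauchy–Binet for the almost-principal minors of `Σ = E[σσᵀ]`, plus `det Σ > 0`):
to be proved in crux-plan from `det_mul_eq_sum_strictMono` (Literature.Analysis.TotalPositivity) or
Mathlib's `Matrix.det_mul`/`Matrix.adjugate` API. -/
def ReplicaBridge : Prop :=
  ReplicaCrossProductIneq → Summit.CriticalPhenomena.Ising3DConformalLimit.Theses.PrecisionLaplacian.InverseMFerromagnet

end Summit.CriticalPhenomena.Ising3DConformalLimit.Cruxes.InverseMFerromagnet.Sketch
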